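import Summits.BirchSwinnertonDyer.BirchSwinnertonDyer.Theorems.PrintX8MazurTateThreeCollapse
import HarnessLib

/-!
# Route `PrintX8`, crux `MuBoundSmallImageX8` (stmt-BirchSwinnertonDyer-20622), LINE «vertical Stevens at 3»,
# part 4: the CONVERSE per pair — a certified Mazur–Tate layer (`θ_n ≢ 0 mod 3`), or the unit case
# `ord₃[0]⁺ = 0`, FORCES a non-constant winding symbol; hence «VS-1 at an X8 pair ⟺ unit case ∨ some
# layer has `μ(θ_n) = 0`» is a kernel equivalence, and every census cell with a certified layer is a
# VS-1 witness (cell `bsd-print-x8`, D-0131 (2) print tier, prover seat p3 g3; `--supports` 20622, closes nothing)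

PARTITION (cell bsd-print-x8, leaf `ClassX8` = `3` good supersingular with `a_3 = ±3`): BC5-type witnesses
and the honest equivalence for the planner's LINE «vertical Stevens at 3» (memo
`run/shared/lean/pub/bsd-print-x8/plan/vs/LINE-VERTICAL-STEVENS-AT-3.md` §1 «Equivalences to be honest
about»: on an X8 pair, VS-1 ⟺ «∃ x ∈ ℤ[1/3], [x]⁺_f a 3-adic unit» ⟺ «unit case ∨ ∃ n, μ(θ_n) = 0»).
Parts 1–3 (`PrintX8MazurTateThreeCollapse`, `PrintX8VerticalStevensCollapse`, `PrintX8VerticalStevens`)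
proved VS-1 ⟹ one colour ⟹ crux 20622 by name; this file proves the two converse arrows.  Closes NO item,
moves 0 census cells; BSD is not proved by any of this.  THEOREMS ONLY; no definition, no named fact.

## Contents

* §1 `exists_norm_ratPlusSymbol_eq_one_of_red_ne_zero` (p = 3, `a_3 ≢ 1 (mod 3)`): if the integral model
  `Θ` of `θ_n(f)` has `red Θ ≠ 0` (e.g. a two-engine certificate `Θ ≠ 0 ∧ μ(Θ) = 0`), then some symbol
  `[c/3^{n+1}]⁺_f` with `3 ∤ c` is a `3`-adic unit — the collapse identity of part 1
  (`coeff_comp_mazurTateElement_of_three`: the `(1+T)ˢ`-coefficients of `θ_n` are `2[γˢ/3^{n+1}]⁺`) read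
  backwards, with `deg θ_n < 3ⁿ` (`natDegree_mazurTateElement_lt`).
* §2 `one_le_norm_sub_of_norm_ratPlusSymbol_eq_one` (ANY `p`, rational newform, `p ∤ N`,
  NON-EISENSTEIN `a_p ≢ p + 1 (mod p)`): a unit symbol `[c/pᴸ]⁺_f` forces
  `‖[a/p^{L+1}]⁺ − [a'/p^{L+1}]⁺‖_p ≥ 1` for some `a, a' ∈ ℤ`.  Proof: the Hecke relation at `r = c/pᴸ`
  (`sum_range_ratPlusSymbol_div_eq_sub`, MTT (4.2)) reads `∑_{j<p} ([(r+j)/p]⁺ − [r]⁺) + ([pr]⁺ − [r]⁺)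
  = (a_p − p − 1)[r]⁺`; if all `p + 1` differences had norm `< 1` so would the left side (ultrametric),
  while the right side has norm `1`.  (The «`T_p`-eigenvalue trick» of the planner memo §3b; on X8
  `a_3 − 4 ∈ {−1, −7}`.)
* §3 X8 per pair: `ClassX8.one_le_norm_sub_of_mazurTate_muZero` (certified layer ⟹ VS-1 at the pair; the
  ty3 records `CertificateMazurTateRecords*` + the consumer pattern of `PrintX8MazurTateMuRider` make every
  one of the 61 census cells a VS-1 witness), `ClassX8.one_le_norm_sub_of_padicValRat_ratPlusSymbol_zero`
  (unit case ⟹ VS-1), and the equivalence `ClassX8.one_le_norm_sub_iff` — VS-1 at the pair ⟺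
  `‖[0]⁺_f‖₃ = 1 ∨ ∃ n Θ, ι Θ = θ_n ∧ red Θ ≠ 0` — NO Sprung pair needed (the integral model of `θ_n`
  exists on X8 by Sprung 2017 Cor. 4.10, `exists_map_eq_map_mazurTateElement_of_not_dvd`).

beyond-print: yes (modest).  References: [Pollack2003] Def. 6.15; [Sprung2017] Cor. 4.10;
[MazurTateTeitelbaum1986Invent] §I.4 (4.2), §I.8; [Kurihara2002] Thm. 0.1; [PerrinRiou2003] §6.1; files
part 1 `Theorems/PrintX8MazurTateThreeCollapse.lean` (p558954), `Theorems/PrintX8MazurTateMuRider.lean`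
(p546221), `Rank1Residual/PrintX8/CertificateMazurTate.lean` (ty3 schema),
`Literature/…/Sprung2017/SharpFlatPAdicLFunctionProofs.lean`.
-/

set_option autoImplicit false
-- justification: the mandated namespace `Summit.BirchSwinnertonDyer.BirchSwinnertonDyer.Theorems`
-- (single-conjunct summit, Sub = Summit) repeats a segment by design (D-0017).
set_option linter.dupNamespace false

noncomputable section

open scoped Classical MatrixGroups ModularForm

open CongruenceSubgroup Polynomial WeierstrassCurve Literature.NumberTheory.EllipticCurves
  Literature.NumberTheory.EllipticCurves.ModularForms
  Literature.NumberTheory.EllipticCurves.Sprung2017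
  Literature.NumberTheory.EllipticCurves.Rank1Residual
  Literature.NumberTheory.EllipticCurves.GreenbergVatsal2000
  Summit.BirchSwinnertonDyer.Rank1Residual.X1.MuLambda
  Summit.BirchSwinnertonDyer.Rank1Residual.Supersingular
  Summit.BirchSwinnertonDyer.BirchSwinnertonDyer.Theorems.PrintX8MazurTateMuRider
  Summit.BirchSwinnertonDyer.BirchSwinnertonDyer.Theorems.PrintX8MazurTateThreeCollapse

namespace Summit.BirchSwinnertonDyer.BirchSwinnertonDyer.Theorems.PrintX8VerticalStevensConverse

/-! ### §1. `θ_n ≢ 0 (mod 3)` ⟹ a unit symbol `[c/3^{n+1}]⁺_f` -/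

section UnitSymbol

variable {N : ℕ} [NeZero N] (f : CuspForm (Gamma0 N) 2) {p : ℕ} [hp : Fact p.Prime]

/-- **A certified layer gives a unit symbol** (`p = 3`, rational newform `f` of level prime to `3`,
`a_3 ≢ 1 (mod 3)`): if the integral model `Θ ∈ Λ` of `θ_n(f)` (`ι Θ = θ_n`) satisfies `red Θ ≠ 0` — e.g.
`Θ ≠ 0 ∧ μ(Θ) = 0`, the census's two-engine certificate — then `[c/3^{n+e₀}]⁺_f` is a `3`-adic unit for
some `c` prime to `3`.  Proof: `θ_n = ι P`, `P ∈ ℤ_3[T]`, `P̄ ≠ 0`; `P̄ = Q̄ ∘ (X + 1)` with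
`Q = P ∘ (X − 1)`, so some coefficient of `Q̄` is non-zero, of index `k ≤ deg θ_n < 3ⁿ`; that coefficient
is `2[γᵏ/3^{n+1}]⁺_f` (`coeff_comp_mazurTateElement_of_three`), a unit, and `γᵏ` is a unit mod `3^{n+1}`.
[cite: Pollack2003, Def. 6.15] [cite: Sprung2017, Cor. 4.10] -/
theorem exists_norm_ratPlusSymbol_eq_one_of_red_ne_zero (hp3 : p = 3) (hf0 : IsNewform0 f)
    (hpN : ¬ p ∣ N) {ap : ℤ} (hap : cuspCoeff f p = ap) (hpa : ¬ (p : ℤ) ∣ ap - 1)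
    {n : ℕ} {Θ : IwasawaAlgebra p}
    (hΘ : iwasawaToPowerSeries p Θ =
      ((mazurTateElement f p n).map (algebraMap ℚ ℚ_[p]) : PowerSeries ℚ_[p]))
    (hred : red Θ ≠ 0) :
    ∃ c : ℕ, ¬ p ∣ c ∧
      ‖((ratPlusSymbol f ((c : ℚ) / (p : ℚ) ^ (n + cyclotomicExponent p)) : ℚ) : ℚ_[p])‖ = 1 := by
  classical
  have hp2 : p ≠ 2 := by omega
  haveI := neZero_torsionOrder p
  haveI : Fintype (rootsOfUnity (torsionOrder p) ℤ_[p]) := Fintype.ofFinite _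
  haveI : NeZero (p ^ (n + cyclotomicExponent p)) := ⟨pow_ne_zero _ hp.out.ne_zero⟩
  -- the integral model as a polynomial
  obtain ⟨P, hP⟩ := exists_map_eq_map_mazurTateElement_of_not_dvd hp2 hf0 hpN hap hpa n
  have hPΘ : (P : PowerSeries ℤ_[p]) = Θ := by
    apply iwasawaToPowerSeries_injective p
    rw [hΘ, ← hP, Polynomial.polynomial_map_coe]
  -- `Q = P ∘ (X - 1)` has a non-zero reduction
  set Q : ℤ_[p][X] := P.comp (X - 1) with hQ
  have hPQ : P = Q.comp (X + 1) := by
    rw [hQ, comp_assoc, sub_comp, X_comp, one_comp, add_sub_cancel_right, comp_X]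
  have hQred : Q.map (IsLocalRing.residue ℤ_[p]) ≠ 0 := by
    intro h0
    apply hred
    change PowerSeries.map (IsLocalRing.residue ℤ_[p]) Θ = 0
    rw [← hPΘ, ← Polynomial.polynomial_map_coe, hPQ, Polynomial.map_comp, h0, zero_comp,
      Polynomial.coe_zero]
  -- a non-zero coefficient of index `k < p^n`
  set k := (Q.map (IsLocalRing.residue ℤ_[p])).natDegree with hk
  have hcoeffk : (Q.map (IsLocalRing.residue ℤ_[p])).coeff k ≠ 0 := by
    rw [hk, coeff_natDegree]
    exact leadingCoeff_ne_zero.mpr hQred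
  have hdegθ : (mazurTateElement f p n).natDegree < p ^ n := natDegree_mazurTateElement_lt f p n
  have hklt : k < p ^ n := by
    have h1 : k ≤ Q.natDegree := natDegree_map_le
    have h2 : Q.natDegree ≤ P.natDegree * (X - 1 : ℤ_[p][X]).natDegree := natDegree_comp_le
    have h3 : (X - 1 : ℤ_[p][X]).natDegree = 1 := by rw [← C_1, natDegree_X_sub_C]
    have h4 : P.natDegree = (mazurTateElement f p n).natDegree := by
      rw [← natDegree_map_eq_of_injective (IsFractionRing.injective ℤ_[p] ℚ_[p]) P, hP,
        natDegree_map_eq_of_injective (algebraMap ℚ ℚ_[p]).injective]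
    rw [h3, mul_one, h4] at h2
    omega
  -- that coefficient of `Q` is a unit of `ℤ_p`, and it is `2[γ^k/p^{n+e₀}]⁺`
  have hunit : IsUnit (Q.coeff k) := by
    rw [← IsLocalRing.residue_ne_zero_iff_isUnit]
    rwa [Polynomial.coeff_map] at hcoeffk
  have h2 : (Q.map (algebraMap ℤ_[p] ℚ_[p])).coeff k =
      ((((mazurTateElement f p n).comp (X - 1)).coeff k : ℚ) : ℚ_[p]) := by
    have h := congr_arg (fun q ↦ Polynomial.coeff q k)
      (show Q.map (algebraMap ℤ_[p] ℚ_[p]) =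
        ((mazurTateElement f p n).comp (X - 1)).map (algebraMap ℚ ℚ_[p]) by
        rw [hQ, Polynomial.map_comp, Polynomial.map_comp, hP, Polynomial.map_sub, Polynomial.map_sub,
          Polynomial.map_X, Polynomial.map_X, Polynomial.map_one, Polynomial.map_one])
    simp only [Polynomial.coeff_map, eq_ratCast] at h
    rw [Polynomial.coeff_map]
    exact h
  have hnorm : ‖((((mazurTateElement f p n).comp (X - 1)).coeff k : ℚ) : ℚ_[p])‖ = 1 := by
    rw [← h2, Polynomial.coeff_map]
    change ‖((Q.coeff k : ℤ_[p]) : ℚ_[p])‖ = 1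
    rw [← PadicInt.norm_def]
    exact PadicInt.isUnit_iff.mp hunit
  rw [coeff_comp_mazurTateElement_of_three f hp3 n hklt, Rat.cast_mul, norm_mul, Rat.cast_ofNat] at hnorm
  have h2n : ‖((2 : ℕ) : ℚ_[p])‖ = 1 :=
    Padic.norm_natCast_eq_one_iff.mpr ((Nat.coprime_primes hp.out Nat.prime_two).mpr hp2)
  rw [Nat.cast_ofNat] at h2n
  rw [h2n, one_mul] at hnorm
  -- `γ^k` is a unit modulo `p^{n+e₀}`, so its representative is prime to `p`
  refine ⟨((cyclotomicGenerator p : ZMod (p ^ (n + cyclotomicExponent p))) ^ k).val, ?_, hnorm⟩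
  have hu : IsUnit ((cyclotomicGenerator p : ZMod (p ^ (n + cyclotomicExponent p))) ^ k) :=
    (isUnit_cyclotomicGenerator_cast p _).pow k
  have hcop : Nat.Coprime (hu.unit : ZMod (p ^ (n + cyclotomicExponent p))).val
      (p ^ (n + cyclotomicExponent p)) := ZMod.val_coe_unit_coprime hu.unit
  rw [IsUnit.unit_spec] at hcop
  have hcop' : Nat.Coprime ((cyclotomicGenerator p : ZMod (p ^ (n + cyclotomicExponent p))) ^ k).val p :=
    (Nat.coprime_pow_right_iff (Nat.pos_of_ne_zero (by
      have := cyclotomicExponent_ne_zero p; omega)) _ _).mp hcop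
  exact (Nat.Prime.coprime_iff_not_dvd hp.out).mp hcop'.symm

end UnitSymbol

/-! ### §2. Non-Eisenstein `a_p`: a unit symbol forces a non-constant winding symbol (any `p`) -/

section NonConstant

variable {N : ℕ} [NeZero N] (f : CuspForm (Gamma0 N) 2) {p : ℕ} [hp : Fact p.Prime]

/-- **A unit symbol forces non-constancy modulo `p`** (ANY prime `p`, rational newform `f` of level
prime to `p`, `a_p ≢ p + 1 (mod p)`, i.e. `f` is not Eisenstein at `p`): if `[c/pᴸ]⁺_f` is a `p`-adic
unit then `‖[a/p^{L+1}]⁺_f − [a'/p^{L+1}]⁺_f‖_p ≥ 1` for some integers `a, a'`.  Proof: with `r = c/pᴸ`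
the Hecke relation `∑_{j<p} [(r+j)/p]⁺ = a_p [r]⁺ − [pr]⁺` (MTT (4.2)) gives
`∑_{j<p} ([(r+j)/p]⁺ − [r]⁺) + ([pr]⁺ − [r]⁺) = (a_p − p − 1)·[r]⁺`, of norm `1`; so one of the `p + 1`
differences on the left (all between symbols of level `p^{L+1}`) has norm `≥ 1` (ultrametric inequality).
[cite: MazurTateTeitelbaum1986Invent, §I.4 (4.2)] -/
theorem one_le_norm_sub_of_norm_ratPlusSymbol_eq_one (hf0 : IsNewform0 f) (hQ : coeffField f = ⊥)
    (hpN : ¬ p ∣ N) {ap : ℤ} (hap : cuspCoeff f p = ap) (hE : ¬ (p : ℤ) ∣ ap - p - 1)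
    {c L : ℕ} (hc : ‖((ratPlusSymbol f ((c : ℚ) / (p : ℚ) ^ L) : ℚ) : ℚ_[p])‖ = 1) :
    ∃ (n : ℕ) (a a' : ℤ), 1 ≤ ‖((ratPlusSymbol f ((a : ℚ) / (p : ℚ) ^ n) -
      ratPlusSymbol f ((a' : ℚ) / (p : ℚ) ^ n) : ℚ) : ℚ_[p])‖ := by
  by_contra hcon
  push Not at hcon
  have hp0 : (p : ℚ) ≠ 0 := Nat.cast_ne_zero.mpr hp.out.ne_zero
  set r : ℚ := (c : ℚ) / (p : ℚ) ^ L with hr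
  -- the symbols of the Hecke relation at `r`, written at level `p^{L+1}` with integer numerators
  have hy : r = (((p * c : ℕ) : ℤ) : ℚ) / (p : ℚ) ^ (L + 1) := by
    rw [hr]
    push_cast
    rw [pow_succ]
    field_simp
  have hx : ∀ j : ℕ, (r + j) / p = (((c + p ^ L * j : ℕ) : ℤ) : ℚ) / (p : ℚ) ^ (L + 1) := by
    intro j
    rw [hr]
    push_cast
    rw [pow_succ]
    field_simp
  have hz : (p : ℚ) * r = (((p ^ 2 * c : ℕ) : ℤ) : ℚ) / (p : ℚ) ^ (L + 1) := by
    rw [hr]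
    push_cast
    rw [pow_succ]
    field_simp
    ring
  -- every difference has norm `< 1`
  have hdx : ∀ j ∈ Finset.range p,
      ‖((ratPlusSymbol f ((r + j) / p) : ℚ) : ℚ_[p]) - ((ratPlusSymbol f r : ℚ) : ℚ_[p])‖ < 1 := by
    intro j _
    have h := hcon (L + 1) ((c + p ^ L * j : ℕ) : ℤ) ((p * c : ℕ) : ℤ)
    rw [← hx j, ← hy, Rat.cast_sub] at h
    exact h
  have hdz : ‖((ratPlusSymbol f (p * r) : ℚ) : ℚ_[p]) - ((ratPlusSymbol f r : ℚ) : ℚ_[p])‖ < 1 := by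
    have h := hcon (L + 1) ((p ^ 2 * c : ℕ) : ℤ) ((p * c : ℕ) : ℤ)
    rw [← hz, ← hy, Rat.cast_sub] at h
    exact h
  -- the Hecke relation, cast to `ℚ_p`, as an identity between the differences
  have hH := sum_range_ratPlusSymbol_div_eq_sub hf0 hQ hpN hap r
  have hid : (∑ j ∈ Finset.range p,
      (((ratPlusSymbol f ((r + j) / p) : ℚ) : ℚ_[p]) - ((ratPlusSymbol f r : ℚ) : ℚ_[p]))) +
      (((ratPlusSymbol f (p * r) : ℚ) : ℚ_[p]) - ((ratPlusSymbol f r : ℚ) : ℚ_[p])) =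
      (((ap - p - 1 : ℤ) : ℚ) : ℚ_[p]) * ((ratPlusSymbol f r : ℚ) : ℚ_[p]) := by
    have hH' := congr_arg (fun q : ℚ ↦ (q : ℚ_[p])) hH
    simp only [Rat.cast_sum, Rat.cast_sub, Rat.cast_mul, Rat.cast_intCast] at hH'
    rw [Finset.sum_sub_distrib, hH', Finset.sum_const, Finset.card_range]
    push_cast
    ring
  -- norm of the left side `< 1`
  have hpos : (Finset.range p).Nonempty := ⟨0, Finset.mem_range.mpr hp.out.pos⟩
  obtain ⟨i, hi, hle⟩ := IsUltrametricDist.exists_norm_finsetSum_le_of_nonempty hpos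
    (fun j : ℕ ↦ ((ratPlusSymbol f ((r + j) / p) : ℚ) : ℚ_[p]) - ((ratPlusSymbol f r : ℚ) : ℚ_[p]))
  have hsum : ‖∑ j ∈ Finset.range p,
      (((ratPlusSymbol f ((r + j) / p) : ℚ) : ℚ_[p]) - ((ratPlusSymbol f r : ℚ) : ℚ_[p]))‖ < 1 :=
    hle.trans_lt (hdx i hi)
  have hL : ‖(((ap - p - 1 : ℤ) : ℚ) : ℚ_[p]) * ((ratPlusSymbol f r : ℚ) : ℚ_[p])‖ < 1 := by
    rw [← hid]
    exact (Padic.nonarchimedean _ _).trans_lt (max_lt hsum hdz)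
  -- norm of the right side `= 1`
  have hunitE : ‖(((ap - p - 1 : ℤ) : ℚ) : ℚ_[p])‖ = 1 := by
    rw [Rat.cast_intCast]
    exact le_antisymm (Padic.norm_int_le_one _)
      (not_lt.mp fun h ↦ hE (Padic.norm_intCast_lt_one_iff.mp h))
  rw [norm_mul, hunitE, one_mul, hc] at hL
  exact lt_irrefl _ hL

end NonConstant

/-! ### §3. Class X8, per pair: the converse arrows and the equivalence -/

section Pair

variable {W : WeierstrassCurve ℚ} [W.IsElliptic] [W.IsGloballyMinimal] {N : ℕ} [NeZero N]
  {f : CuspForm (Gamma0 N) 2} {p : ℕ} [hp : Fact p.Prime]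

omit [W.IsElliptic] in
/-- On X8: `3 ∤ a_3 − 1` and `3 ∤ a_3 − 3 − 1` (`a_3 = ±3`). [folklore] -/
theorem ClassX8.not_dvd_frobeniusTrace_sub (hX : ClassX8 W p) :
    ¬ ((3 : ℕ) : ℤ) ∣ W.frobeniusTrace 3 - 1 ∧ ¬ ((3 : ℕ) : ℤ) ∣ W.frobeniusTrace 3 - (3 : ℕ) - 1 := by
  have h3 : ((3 : ℕ) : ℤ) ∣ W.frobeniusTrace 3 := hX.2.1.2
  constructor
  · intro h
    have h1 : ((3 : ℕ) : ℤ) ∣ W.frobeniusTrace 3 - (W.frobeniusTrace 3 - 1) := dvd_sub h3 h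
    rw [sub_sub_cancel] at h1
    norm_num at h1
  · intro h
    have h1 : ((3 : ℕ) : ℤ) ∣ W.frobeniusTrace 3 - (W.frobeniusTrace 3 - (3 : ℕ) - 1) := dvd_sub h3 h
    rw [show W.frobeniusTrace 3 - (W.frobeniusTrace 3 - (3 : ℕ) - 1) = 4 by push_cast; ring] at h1
    norm_num at h1

/-- **Class X8, per pair: a certified Mazur–Tate layer forces VS-1.**  For `E = W` in class X8 (ANY
image, any rank), `f` its newform, and an integral model `Θ` of `θ_n(f)` with `Θ ≠ 0` and `μ(Θ) = 0`
(one row of the census's two-engine layer certificates, ty3 `CertificateMazurTateRecords*`), the winding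
symbol of `f` is non-constant modulo `3` on `ℤ[1/3]`: `‖[a/3ᵐ]⁺_f − [a'/3ᵐ]⁺_f‖₃ ≥ 1` for some `m, a, a'`.
So every census cell with a certified layer is a WITNESS of VS-1 at its pair (BC5-type evidence for the
line). [cite: Pollack2003, Def. 6.15] [cite: Sprung2017, Cor. 4.10] [cite: MazurTateTeitelbaum1986Invent, §I.4 (4.2)] -/
theorem ClassX8.one_le_norm_sub_of_mazurTate_muZero (hX : ClassX8 W p) (hf : IsNewformOf W f)
    {n : ℕ} {Θ : IwasawaAlgebra p}
    (hΘ : iwasawaToPowerSeries p Θ =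
      ((mazurTateElement f p n).map (algebraMap ℚ ℚ_[p]) : PowerSeries ℚ_[p]))
    (hΘ0 : Θ ≠ 0) (hμ : mu Θ = 0) :
    ∃ (m : ℕ) (a a' : ℤ), 1 ≤ ‖((ratPlusSymbol f ((a : ℚ) / (p : ℚ) ^ m) -
      ratPlusSymbol f ((a' : ℚ) / (p : ℚ) ^ m) : ℚ) : ℚ_[p])‖ := by
  have hpa := (ClassX8.not_dvd_frobeniusTrace_sub hX)
  obtain ⟨hp3, hss, -⟩ := hX
  subst hp3
  have hgood : W.HasGoodReductionAtPrime 3 := hss.1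
  have hpN : ¬ 3 ∣ N := not_dvd_level_of_isNewformOf hf hgood
  have hap : cuspCoeff f 3 = ((W.frobeniusTrace 3 : ℤ) : ℂ) :=
    cuspCoeff_eq_frobeniusTrace_of_isNewformOf_holds hf hgood
  obtain ⟨c, -, hc⟩ := exists_norm_ratPlusSymbol_eq_one_of_red_ne_zero f rfl hf.1 hpN hap hpa.1 hΘ
    (red_ne_zero_of_mu_eq_zero hΘ0 hμ)
  exact one_le_norm_sub_of_norm_ratPlusSymbol_eq_one f hf.1 hf.coeffField_eq_bot hpN hap hpa.2 hc

/-- **Class X8, per pair: the unit case forces VS-1** — if `[0]⁺_f = L(E,1)/Ω⁺_f` is a `3`-adic unit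
(`[0]⁺ ≠ 0 ∧ ord₃[0]⁺ = 0`, Kurihara's case) then the winding symbol is non-constant modulo `3` (indeed
`[1/3]⁺ − [0]⁺ = ((a_3 − 4)/2)[0]⁺`). [cite: MazurTateTeitelbaum1986Invent, §I.4 (4.2)] [cite: Kurihara2002, Thm. 0.1] -/
theorem ClassX8.one_le_norm_sub_of_norm_ratPlusSymbol_zero_eq_one (hX : ClassX8 W p)
    (hf : IsNewformOf W f) (h0 : ‖((ratPlusSymbol f 0 : ℚ) : ℚ_[p])‖ = 1) :
    ∃ (m : ℕ) (a a' : ℤ), 1 ≤ ‖((ratPlusSymbol f ((a : ℚ) / (p : ℚ) ^ m) -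
      ratPlusSymbol f ((a' : ℚ) / (p : ℚ) ^ m) : ℚ) : ℚ_[p])‖ := by
  have hpa := (ClassX8.not_dvd_frobeniusTrace_sub hX)
  obtain ⟨hp3, hss, -⟩ := hX
  subst hp3
  have hgood : W.HasGoodReductionAtPrime 3 := hss.1
  have hpN : ¬ 3 ∣ N := not_dvd_level_of_isNewformOf hf hgood
  have hap : cuspCoeff f 3 = ((W.frobeniusTrace 3 : ℤ) : ℂ) :=
    cuspCoeff_eq_frobeniusTrace_of_isNewformOf_holds hf hgood
  have hc : ‖((ratPlusSymbol f (((0 : ℕ) : ℚ) / ((3 : ℕ) : ℚ) ^ 0) : ℚ) : ℚ_[3])‖ = 1 := by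
    simpa using h0
  exact one_le_norm_sub_of_norm_ratPlusSymbol_eq_one f hf.1 hf.coeffField_eq_bot hpN hap hpa.2 hc

/-- **Class X8, per pair: VS-1 ⟺ unit case ∨ some layer is `≢ 0 (mod 3)`** — the honest equivalence of
the planner memo («VS-1 is a REFORMULATION whose value is the attack it exposes, not a weakening»),
WITHOUT any Sprung pair: on an X8 pair with newform `f`,
`(∃ m a a', ‖[a/3ᵐ]⁺_f − [a'/3ᵐ]⁺_f‖₃ ≥ 1) ↔ (‖[0]⁺_f‖₃ = 1 ∨ ∃ n Θ, ι Θ = θ_n(f) ∧ red Θ ≠ 0)`.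
(⟹: both symbols are `3`-integral, one is a unit, and it is `[0]⁺` or `[c/3^{n+1}]⁺` with `3 ∤ c`, whence
`red Θ_n ≠ 0` for the integral model `Θ_n = P` of `θ_n` — which exists on X8 by Sprung 2017 Cor. 4.10;
⟸: the two theorems above, `red Θ ≠ 0` sufficing in the first.)
[cite: Pollack2003, Def. 6.15] [cite: Sprung2017, Cor. 4.10] [cite: MazurTateTeitelbaum1986Invent, §I.4 (4.2) and §I.8] -/
theorem ClassX8.one_le_norm_sub_iff (hX : ClassX8 W p) (hf : IsNewformOf W f) :
    (∃ (m : ℕ) (a a' : ℤ), 1 ≤ ‖((ratPlusSymbol f ((a : ℚ) / (p : ℚ) ^ m) -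
      ratPlusSymbol f ((a' : ℚ) / (p : ℚ) ^ m) : ℚ) : ℚ_[p])‖) ↔
    (‖((ratPlusSymbol f 0 : ℚ) : ℚ_[p])‖ = 1 ∨
      ∃ (n : ℕ) (Θ : IwasawaAlgebra p), iwasawaToPowerSeries p Θ =
        ((mazurTateElement f p n).map (algebraMap ℚ ℚ_[p]) : PowerSeries ℚ_[p]) ∧ red Θ ≠ 0) := by
  have hpa := (ClassX8.not_dvd_frobeniusTrace_sub hX)
  have hX' := hX
  obtain ⟨hp3, hss, -⟩ := hX
  subst hp3
  have hp2 : (3 : ℕ) ≠ 2 := by decide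
  have hgood : W.HasGoodReductionAtPrime 3 := hss.1
  have hf0 : IsNewform0 f := hf.1
  have hpN : ¬ 3 ∣ N := not_dvd_level_of_isNewformOf hf hgood
  have hap : cuspCoeff f 3 = ((W.frobeniusTrace 3 : ℤ) : ℂ) :=
    cuspCoeff_eq_frobeniusTrace_of_isNewformOf_holds hf hgood
  constructor
  · rintro ⟨m, a, a', hVS⟩
    -- integrality of every `[b/3ᵐ]⁺`, `b ∈ ℤ`
    have hint : ∀ b : ℤ, ‖((ratPlusSymbol f ((b : ℚ) / ((3 : ℕ) : ℚ) ^ m) : ℚ) : ℚ_[3])‖ ≤ 1 := by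
      intro b
      rcases ratPlusSymbol_intCast_div_pow_cases f 3 m b with h | ⟨m', c, -, h⟩
      · rw [h]
        have h0 := norm_ratPlusSymbol_div_pow_le_one_of_not_dvd hp2 hf0 hpN hap hpa.1 0 0
        simpa using h0
      · rw [h]
        exact norm_ratPlusSymbol_div_pow_le_one_of_not_dvd hp2 hf0 hpN hap hpa.1 c (m' + 1)
    -- a unit symbol gives the right-hand side
    have key : ∀ b : ℤ, ‖((ratPlusSymbol f ((b : ℚ) / ((3 : ℕ) : ℚ) ^ m) : ℚ) : ℚ_[3])‖ = 1 →
        (‖((ratPlusSymbol f 0 : ℚ) : ℚ_[3])‖ = 1 ∨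
          ∃ (n : ℕ) (Θ : IwasawaAlgebra 3), iwasawaToPowerSeries 3 Θ =
            ((mazurTateElement f 3 n).map (algebraMap ℚ ℚ_[3]) : PowerSeries ℚ_[3]) ∧ red Θ ≠ 0) := by
      intro b hb
      rcases ratPlusSymbol_intCast_div_pow_cases f 3 m b with h | ⟨n, c, hc, h⟩
      · left
        rwa [h] at hb
      · right
        rw [h] at hb
        obtain ⟨P, hP⟩ := exists_map_eq_map_mazurTateElement_of_not_dvd hp2 hf0 hpN hap hpa.1 n
        have hΘ : iwasawaToPowerSeries 3 (P : PowerSeries ℤ_[3]) =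
            ((mazurTateElement f 3 n).map (algebraMap ℚ ℚ_[3]) : PowerSeries ℚ_[3]) := by
          rw [← hP, Polynomial.polynomial_map_coe]
        have he : cyclotomicExponent 3 = 1 := if_neg hp2
        exact ⟨n, P, hΘ, red_ne_zero_of_mazurTate_of_norm_ratPlusSymbol_eq_one f rfl hf0 hpN hap hpa.1
          hΘ hc (by rw [he]; exact hb)⟩
    rw [Rat.cast_sub] at hVS
    have hmax := Padic.nonarchimedean
      ((ratPlusSymbol f ((a : ℚ) / ((3 : ℕ) : ℚ) ^ m) : ℚ) : ℚ_[3])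
      (-((ratPlusSymbol f ((a' : ℚ) / ((3 : ℕ) : ℚ) ^ m) : ℚ) : ℚ_[3]))
    rw [norm_neg, ← sub_eq_add_neg] at hmax
    rcases le_max_iff.mp (hVS.trans hmax) with h | h
    · exact key a (le_antisymm (hint a) h)
    · exact key a' (le_antisymm (hint a') h)
  · rintro (h0 | ⟨n, Θ, hΘ, hred⟩)
    · exact ClassX8.one_le_norm_sub_of_norm_ratPlusSymbol_zero_eq_one hX' hf h0
    · obtain ⟨c, -, hc⟩ := exists_norm_ratPlusSymbol_eq_one_of_red_ne_zero f rfl hf0 hpN hap hpa.1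
        hΘ hred
      exact one_le_norm_sub_of_norm_ratPlusSymbol_eq_one f hf0 hf.coeffField_eq_bot hpN hap hpa.2 hc

end Pair

end Summit.BirchSwinnertonDyer.BirchSwinnertonDyer.Theorems.PrintX8VerticalStevensConverse

end
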